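import Literature.Barriers.AtomisticToContinuum.HalfFillingDischarges
import HarnessLib

/-!
# Hard-core lattice bosons: the symmetric facts (Sᵀ), (Tᵀ), (Cᵀ) do not use half filling

`Literature/Barriers/AtomisticToContinuum`; audit-evidence file (refuter barrier-audit of
`HalfFillingDischarges.lean`, 2026-08-15) backing the sentence "(Cᵀ), (Sᵀ), (Tᵀ) hold verbatim
with a chemical potential `μΣ_x S³_x` (any filling; checked in Lean)" in the `scope_caveats:` of
the barrier block `Literature.Barriers.AtomisticToContinuum.HalfFillingReflectionPositivity`.
No statement or definition is introduced; the three theorems below are the filling-independent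
forms of the discharges of `HalfFillingDischarges.lean`:

* `quarterTurn_conj_hardCoreLatticeGas_add_chemPot`, `thermalCorr_two_eq_one_add_chemPot` —
  (Sᵀ) `⟨S²_xS²_y⟩_β = ⟨S¹_xS¹_y⟩_β` for `H_μ = hardCoreLatticeGas d L λ + μ Σ_x S³_x`, i.e. the
  hard-core lattice gas at ANY chemical potential `μ` (any filling): the global quarter turn
  about the 3-axis fixes every `S³_x`, hence `H_μ`, and Gibbs states are invariant under
  unitaries commuting with `H` (`Matrix.gibbsState_conj_of_commute`) [LSSY2005, Ch. 11 §11.1: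
  "invariant under simultaneous rotations of all the spins around the 3-axis ... the U(1) gauge
  symmetry associated with particle number conservation"];
* `abs_re_gibbsState_siteSpin_mul_le` — (Tᵀ) `|Re ⟨Sᵅ_xSᵅ_y⟩_β| ≤ ¼` for EVERY Hermitian spin-½
  Hamiltonian on every finite lattice (Löwner bounds `¼ ± Sᵅ_xSᵅ_y ≥ 0`, positivity and
  normalisation of Gibbs states);
* (Cᵀ), the sum rule, is state-independent as it stands: it is the tree's Fourier identity
  `Literature.MathematicalPhysics.QuantumLattice.sum_structureFactor_mul_cos`, valid for any
  symmetric kernel `G`.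

Consequently, in the tree's sorry-free proof `HalfFillingReflectionPositivity_holds` the
particle–hole reflection `θ∘V` enters only through Gaussian domination (Aᵀ)
(`hc_partitionFn_field_le`), in agreement with [DLS1978, §1]: the transfer bounds "depend on no
special properties of the Hamiltonian", only Gaussian domination is model-specific.

## References

* [LSSY2005] E. H. Lieb, R. Seiringer, J. P. Solovej, J. Yngvason, *The Mathematics of the Bose
  Gas and its Condensation* (2005), Ch. 11 §11.1 (p. 135).
* [DLS1978] F. J. Dyson, E. H. Lieb, B. Simon, J. Stat. Phys. 18 (1978) 335–383, §1.
-/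

noncomputable section

open Matrix Finset
open Literature.MathematicalPhysics.QuantumLattice Literature.Probability.LatticeModels
open scoped ComplexOrder

namespace Literature.Barriers.AtomisticToContinuum.BoseGas

variable {d : ℕ}

/-! ### (Sᵀ) at any filling -/

/-- **`U(1)` symmetry at any filling**: the global quarter turn about the 3-axis fixes
`hardCoreLatticeGas d L λ + μ Σ_x S³_x` for every chemical potential `μ` (it fixes
`hardCoreLatticeGas` and every `S³_x`). [cite: LSSY2005, Ch. 11 §11.1] -/
theorem quarterTurn_conj_hardCoreLatticeGas_add_chemPot (d L : ℕ) [NeZero L] (lam μ : ℝ) :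
    productOp (fun _ : TorusSite d L => diagonal fun k : Fin 2 => (-Complex.I) ^ (k : ℕ)) *
        (hardCoreLatticeGas d L lam + (μ : ℂ) • ∑ x : TorusSite d L, siteSpin 1 x 2) *
        (productOp (fun _ : TorusSite d L => diagonal fun k : Fin 2 => (-Complex.I) ^ (k : ℕ)))ᴴ =
      hardCoreLatticeGas d L lam + (μ : ℂ) • ∑ x : TorusSite d L, siteSpin 1 x 2 := by
  set U : Op (TorusSite d L) 2 :=
    productOp (fun _ : TorusSite d L => diagonal fun k : Fin 2 => (-Complex.I) ^ (k : ℕ)) with hU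
  have hH : U * hardCoreLatticeGas d L lam * Uᴴ = hardCoreLatticeGas d L lam :=
    quarterTurn_conj_hardCoreLatticeGas d L lam
  have hS3 : ∀ x : TorusSite d L, U * siteSpin 1 x 2 * Uᴴ = siteSpin 1 x 2 :=
    fun x => quarterTurn_conj_siteSpin_two 1 x
  rw [Matrix.mul_add, Matrix.add_mul, hH, Matrix.mul_smul, Matrix.smul_mul, Finset.mul_sum,
    Finset.sum_mul]
  congr 2
  exact sum_congr rfl fun x _ => hS3 x

/-- **(Sᵀ) at any filling**: `⟨S²_xS²_y⟩_β = ⟨S¹_xS¹_y⟩_β` in the Gibbs state of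
`hardCoreLatticeGas d L λ + μ Σ_x S³_x`, for every real `β`, `λ`, `μ` and every side `L ≥ 1`
(invariance of Gibbs states under the quarter turn `U`, `U S² Uᴴ = S¹`). The case `μ = 0` is
`hc_corr_one_eq_zero_holds`. [cite: LSSY2005, Ch. 11 §11.1] -/
theorem thermalCorr_two_eq_one_add_chemPot (d L : ℕ) [NeZero L] (β lam μ : ℝ)
    (x y : TorusSite d L) :
    gibbsState β (hardCoreLatticeGas d L lam + (μ : ℂ) • ∑ z : TorusSite d L, siteSpin 1 z 2)
        (siteSpin 1 x 1 * siteSpin 1 y 1) =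
      gibbsState β (hardCoreLatticeGas d L lam + (μ : ℂ) • ∑ z : TorusSite d L, siteSpin 1 z 2)
        (siteSpin 1 x 0 * siteSpin 1 y 0) := by
  set H : Op (TorusSite d L) 2 :=
    hardCoreLatticeGas d L lam + (μ : ℂ) • ∑ z : TorusSite d L, siteSpin 1 z 2 with hHdef
  set U : Op (TorusSite d L) 2 :=
    productOp (fun _ : TorusSite d L => diagonal fun k : Fin 2 => (-Complex.I) ^ (k : ℕ)) with hU
  have hUU : Uᴴ * U = 1 := productOp_conjTranspose_mul fun _ => spinPhase_conjTranspose_mul 1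
  have hcomm : U * H = H * U := by
    have h : U * H * Uᴴ = H := quarterTurn_conj_hardCoreLatticeGas_add_chemPot d L lam μ
    have h2 : U * H * Uᴴ * U = H * U := by rw [h]
    rw [mul_assoc, hUU, mul_one] at h2
    exact h2
  have hinv := Matrix.gibbsState_conj_of_commute hcomm hUU β (siteSpin 1 x 1 * siteSpin 1 y 1)
  rw [productOp_conj_mul (fun _ => spinPhase_conjTranspose_mul 1),
    quarterTurn_conj_siteSpin_one, quarterTurn_conj_siteSpin_one] at hinv
  rw [hinv]

/-! ### (Tᵀ) for every Hermitian spin-½ Hamiltonian -/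

/-- **(Tᵀ) in general**: `|Re ⟨Sᵅ_x Sᵅ_y⟩_β| ≤ ¼` in the Gibbs state of ANY Hermitian spin-½
Hamiltonian `H` on any finite lattice, for every real `β` (`¼ ∓ Sᵅ_xSᵅ_y ≥ 0` in the Löwner
order, and Gibbs states are positive and normalised). The hard-core lattice gas case is
`hc_corr_abs_le_holds`. [folklore] -/
theorem abs_re_gibbsState_siteSpin_mul_le {Λ : Type*} [Fintype Λ] [DecidableEq Λ]
    {H : Op Λ 2} (hH : H.IsHermitian) (β : ℝ) (α : Fin 3) (x y : Λ) :
    |(gibbsState β H (siteSpin 1 x α * siteSpin 1 y α)).re| ≤ 1 / 4 := by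
  have hone : gibbsState β H 1 = 1 := gibbsState_one β H (partitionFn_pos β hH).ne'
  have hup := gibbsState_nonneg_of_posSemidef β hH
    (posSemidef_sq_smul_one_sub_siteSpin_mul' 1 x y α)
  rw [map_sub, LinearMap.map_smul, hone, smul_eq_mul, mul_one] at hup
  obtain ⟨hup_re, -⟩ := Complex.nonneg_iff.mp hup
  rw [Complex.sub_re, re_half_sq] at hup_re
  have hlo := gibbsState_nonneg_of_posSemidef β hH
    (posSemidef_sq_smul_one_add_siteSpin_mul' 1 x y α)
  rw [map_add, LinearMap.map_smul, hone, smul_eq_mul, mul_one] at hlo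
  obtain ⟨hlo_re, -⟩ := Complex.nonneg_iff.mp hlo
  rw [Complex.add_re, re_half_sq] at hlo_re
  rw [abs_le]
  norm_num at hup_re hlo_re ⊢
  constructor <;> linarith

end Literature.Barriers.AtomisticToContinuum.BoseGas

end
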